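/-
Copyright (c) 2026 the pub-hodgecm-mathlib formalisation cell (harness21).  Prover seat hodgecm-mathlib-LH7-p08 (g0) (re-dealt to strike line L3 `stub_N6nsDyadic` by director
s1969 (a)), Track A «(D-RAM) FOUR-FRAME» squad, helper lane on h413 = stmt-HodgeConjecture-24833 (count-neutral).  β-BOARD v1 row R8 ∕ (P5) «H `(2ρ,2ρ,2ρ)`», FILE 4a: the
per-lattice labelled-odd value on the core-hanging stratum for ANY key under a COLLAPSED label (one slot `k`, sign `ε`), and the collapse for the key `(m, m, L)` down to the
BOUNDARY `L − m = 2d − 2`.  2026-09-04.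
-/
import Summits.HodgeConjecture.HodgeConjecture.Theorems.F0P3cDyRamTwoSlotLabelReadCoreHanging         -- ★ p861388 (this seat, FILE 2a): `valueClassLabel_latt_coreHanging_iff_normSign_linear`
import Summits.HodgeConjecture.HodgeConjecture.Theorems.F0P3cDyRamLabelledOddOneSlotRead               -- ★ p860757-line (F0P3-p01 (g36)): `labelledOddCount_div_relIndex_eq_of_oneSlot`
import Summits.HodgeConjecture.HodgeConjecture.Theorems.F0P3cDyRamDiagonalKappaCoreHangingClass         -- ★ κH-A2 (LH4-p06 (g3)): `chiVec_eq_one_of_mem_fixedUnitStabilizer_of_le`, `exists_mem_fixedUnitStabilizer_chiVec_ne_one_of_lt`; brings ★ κH (A1)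
import Summits.HodgeConjecture.HodgeConjecture.Theorems.F0P3cDyRamDiagonalOrbitFibreTransport           -- ★ (F0P3-p01): `fibre_isCoset_zero`
import Summits.HodgeConjecture.HodgeConjecture.Theorems.F0P3cDyRamDiagonalOrbitFibreCountHeads          -- ★: `finite_unitTorus_orbit_of_mem_normalisedStableLattices`
import Summits.HodgeConjecture.HodgeConjecture.Theorems.F0P3cDyRamStableCountTypeZero                    -- ★ (LH4-p12): `v_diag_eq_one`, `diag_regular`
import Literature.NumberTheory.LocalFields.WildQuadraticDatumNormSignConductor                          -- ★ toolkit: `normSign_eq_one_of_fixed_of_v_sub_one_le`, `normSign_mul_of_fixed`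
import Literature.NumberTheory.LocalFields.WildQuadraticDatumNonNormUnit                                -- ★ `exists_nonnorm_dichotomy_of_isRamifiedQuadraticDatum` (unit non-norm + full dichotomy)
import Literature.NumberTheory.LocalFields.ValuedCompleteIsAdicComplete                                 -- ★ `isAdicComplete_valuedInteger_of_completeSpace`
import HarnessLib

/-!
# Crux `H413`, line LH4 «(D-RAM) FOUR-FRAME» — (β) table, β-BOARD row R8 ∕ (P5), FILE 4a: «THE COLLAPSED READ: IF THE (β) LABEL ON `S_F` OF A CORE-HANGING LATTICE IS `ε·ω(u_k)`, THE
# LABELLED-ODD VALUE IS `w(M)∕2 · ω(D_i)·ε·[i = k ∨ 2d−1 ≤ ρ]`; AND THE KEY `(m, m, L)` COLLAPSES TO SLOT 2 WITH `ε = ω(f·g_α + g_β)` DOWN TO THE BOUNDARY `L − m = 2d − 2`»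

Cell `hodgecm-mathlib` (D-0151), FLOOR 0, crux item H413 = `stmt-HodgeConjecture-24833`, route `HCCMUnconditional`; squad F0∕P3c∕LH4.  THEOREMS ONLY (no `def`, no instance, no
notation, no `sorry`, default heartbeats); ★-only imports; lane `--supports stmt-HodgeConjecture-24833 --as helper` (count-neutral); pays NO row, states NO law.

THE MATHEMATICS (this seat's H-ROW DERIVATION v1 e4da7f0103cc4a29 §3 and its addendum 386f7598 §A).  Let `M = latt(1 0 0; x ϖ^ρ 0; xζ+f·xζ ϖ^ρζ ϖ^{2ρ})` be a member of the
core-hanging orbit of `V_H(1,1,f)` (`x, ζ` units, `f` a σ-FIXED unit, `|1+f| = 1`, `ρ ≥ 1`), on the clean shell and `T`-stable, with its ★ κH (A1) polarisation `D`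
(`(ω(D₀),ω(D₁),ω(D₂)) = (ω(f), 1, ω(−(1+f)))`).  By ★ p861388 (FILE 2a) the (β) label of the class `D·u`, `u ∈ S_F(M)`, is `ω(u₀·f·g_α + u₁·g_β)` (`g_α, g_β` fixed approximants of
`(α−1)∕t₊`, `(β−1)∕t₊` to precision `ϖ^{m*}` after the weight `π₀^{−ρ}`).
* §1 **THE COLLAPSED READ** (the common engine of FILEs 3a∕3c∕3e, exported once with the collapse as a HYPOTHESIS): if `u₀·f·g_α + u₁·g_β ≠ 0` and
  `ω(u₀·f·g_α + u₁·g_β) = ε·ω(u_k)` for every `u ∈ S_F(M)` (`ε = ±1`, a slot `k`), then F0P3-p01's ★ ONE-SLOT head gives, slot by slot,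
  `m^Λ_i(M)∕[𝒰 : N′] = w(M)∕2 · ω(D_i)·ε·[i = k ∨ 2d−1 ≤ ρ]` — the pair indicator `[ω(u_i)ω(u_k) ≡ 1 on S_F]` being `1` on the diagonal and ★ κH-A2's alive ∕ dead window off it.
* §2 **THE COLLAPSE FOR THE KEY `(m, m, L)` DOWN TO THE BOUNDARY.**  The ★ `S_F` letters `|u₂ − u₁| ≤ |ϖ|^ρ`, `|f⁻¹(u₂−u₁) + (u₂−u₀)| ≤ |ϖ|^{2ρ}` give the identity
  `u₀·f·g_α + u₁·g_β = u₂·G + E`, `G = f·g_α + g_β`, `E = g_α·((u₀f+u₁) − (1+f)u₂) + (u₁−u₂)(g_β − g_α)`, `|E| ≤ max(|ϖ|^{2ρ}|g_α|, |ϖ|^ρ|g_β − g_α|)`; so whenever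
  `|ϖ|^{2ρ}|g_α| ≤ |ϖ|^{2d−1}|G|` and `|ϖ|^ρ·|g_β − g_α| ≤ |ϖ|^{2d−1}|G|` (DEEP: `|g_β − g_α| ≤ |ϖ|^{2d−1}|g_α|`; BOUNDARY `L − m = 2d−2`: `|g_β − g_α| = |ϖ|^{2d−2}|g_α|` and `ρ ≥ 1`):
  `ω(u₀·f·g_α + u₁·g_β) = ω(f·g_α + g_β)·ω(u₂)` — ONE-SLOT in slot 2 with `ε = ω(f·g_α + g_β)` (at the boundary `ε = ω(g_α)ω(1+f)·ψ₀(1∕(1+f̄))`, `ψ₀(c̄) = ω(1 + δc)`,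
  `δ = (g_β − g_α)∕g_α`: the additive character of the derivation's boundary term).
* §3 the per-lattice value for the key `(m, m, L)` under the §2 letters (§1 at `k = 2`).
HONEST LABEL.  Count-neutral (`--supports`); the boundary stratum sums (additive character sums over the admissible classes), the keys `(m,L,m)`∕`(L,m,m)` at the boundary, the shallow
keys, the R8 value, `hRest`, (T3), (β-BAL), (β), T₊ stay OPEN; `HC_CM` is proved only modulo the 7 printed citations (2 remaining named inputs: hLiu418 = `stmt-HodgeConjecture-24832`,
h413 = `stmt-HodgeConjecture-24833`) until rung 0 closes.

## References
* [Kottwitz1986BaseChangeUnits] R. E. Kottwitz, *Base change for unit elements of Hecke algebras*, Compositio Math. 60 (1986), §1 pp. 240–241 (signed lattice counts modulo the torus).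
* [LanglandsShelstad1987] R. P. Langlands, D. Shelstad, *On the definition of transfer factors*, Math. Ann. 278 (1987), §3.
* [Rogawski1990] J. D. Rogawski, *Automorphic Representations of Unitary Groups in Three Variables*, Ann. of Math. Stud. 123 (1990), §4.9 Prop. 4.9.1 (a)(b) p. 55, §4.10 p. 58.
* [Serre1979] J.-P. Serre, *Local Fields*, GTM 67 (1979), Ch. V §3 Cor. 3, Ch. XV §2 (the conductor of the quadratic character).
-/

set_option autoImplicit false

noncomputable section

namespace Summit.HodgeConjecture.HodgeConjecture.Cruxes.H413.F0P3cDyRamLabelledOddCoreHangingCollapsedRead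

open Matrix WithZero
open Literature.NumberTheory.Automorphic Literature.NumberTheory.Automorphic.HermitianLattice Literature.NumberTheory.Automorphic.UnitaryGroup
open Literature.NumberTheory.Automorphic.UnitaryLatticeTree Literature.NumberTheory.Automorphic.UnitaryThreeFourFrame
open Literature.NumberTheory.LocalFields Literature.NumberTheory.LocalFields.WildQuadraticDatum
open Summit.HodgeConjecture.HodgeConjecture.Cruxes.H413.F0P3cDyRamFourFramePieces
open Summit.HodgeConjecture.HodgeConjecture.Cruxes.H413.F0P3cDyRamFourFrameCensusDefs
open Summit.HodgeConjecture.HodgeConjecture.Cruxes.H413.F0P3cDyRamDiagonalTorusDefs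
open Summit.HodgeConjecture.HodgeConjecture.Cruxes.H413.F0P3cDyRamLabelledOddCountDefs
open Summit.HodgeConjecture.HodgeConjecture.Cruxes.H413.F0P3cDyRamTwoSlotLabelReadCoreHanging (valueClassLabel_latt_coreHanging_iff_normSign_linear)
open Summit.HodgeConjecture.HodgeConjecture.Cruxes.H413.F0P3cDyRamLabelledOddOneSlotRead (labelledOddCount_div_relIndex_eq_of_oneSlot)
open Summit.HodgeConjecture.HodgeConjecture.Cruxes.H413.F0P3cDyRamDiagonalKappaCoreHangingClass
open Summit.HodgeConjecture.HodgeConjecture.Cruxes.H413.F0P3cDyRamDiagonalCoreHangingPolarisationExplicit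
open Summit.HodgeConjecture.HodgeConjecture.Cruxes.H413.F0P3cDyRamDiagonalGluedFixedStabiliser (mem_fixedUnitStabilizer_latt_glued_iff)
open Summit.HodgeConjecture.HodgeConjecture.Cruxes.H413.F0P3cDyRamDiagonalOrbitFibreTransport (fibre_isCoset_zero)
open Summit.HodgeConjecture.HodgeConjecture.Cruxes.H413.F0P3cDyRamDiagonalOrbitFibreCountHeads (finite_unitTorus_orbit_of_mem_normalisedStableLattices)
open Summit.HodgeConjecture.HodgeConjecture.Cruxes.H413.F0P3cDyRamDiagonalCoreHangingCount (isNormalisedLattice_latt_coreHanging)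
open Summit.HodgeConjecture.HodgeConjecture.Cruxes.H413.F0P3cDyRamStableCountTypeZero (v_diag_eq_one diag_regular)
open Summit.HodgeConjecture.HodgeConjecture.Cruxes.H413.F0P3cDyRamDiagonalKappaSplitCountEval (normSign_mul_self)
open scoped Valued WithZero Matrix MatrixGroups

variable {K : Type} [Field K] [Valued K ℤᵐ⁰]

/-! ## §1  THE COLLAPSED READ — the per-lattice labelled-odd value when the label is `ε·ω(u_k)` on `S_F` -/

/-- **THE LABELLED-ODD VALUE OF A CORE-HANGING LATTICE UNDER A COLLAPSED LABEL.**  Ramified datum (`|2| < 1`, complete, finite residue field), `ρ ≥ 1`; a member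
`M = latt(1 0 0; x ϖ^ρ 0; xζ+f·xζ ϖ^ρζ ϖ^{2ρ})` of the core-hanging stratum (`x, ζ` units, `f` a fixed unit with `|1+f| = 1`) which is `T`-stable and normalised-stable, on the clean shell
(the three tokens), fixed approximants `g_α`, `g_β` (`|ϖ^{−m*}·π₀^{−ρ}·((α−1) − g_α t₊)| ≤ 1`, same for `β`), and the COLLAPSE HYPOTHESIS: for every `u ∈ S_F(M)`, `u₀·f·g_α + u₁·g_β ≠ 0` and
`ω(u₀·f·g_α + u₁·g_β) = ε·ω(u_k)` (`ε = ±1`, `k` a slot).  Then for every slot `i`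
`labelledOddCount σ ϖ 0 i Λ M ∕ [𝒰 : N(S̃(M))] = stabiliserWeight σ M ∕ 2 · (ω(f), 1, ω(−(1+f)))_i · ε · [i = k ∨ 2d−1 ≤ ρ]`, `Λ = valueClassLabel σ ϖ (α−1) (β−1) m* d`
— F0P3-p01's ★ ONE-SLOT head at slot `k` (FILE 2a reads the label as `ω(u₀·f·g_α + u₁·g_β)`), `ω(D) = (ω(f), 1, ω(−(1+f)))` (★ κH (A1)), and the pair indicator `[ω(u_i)ω(u_k) ≡ 1 on S_F]`
is `1` on the diagonal and ★ κH-A2's alive ∕ dead window `[2d−1 ≤ ρ]` off it.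
[cite: Kottwitz1986BaseChangeUnits, §1 pp. 240–241] [cite: LanglandsShelstad1987, §3] [cite: Rogawski1990, §4.9 Prop. 4.9.1 (a)(b) p. 55, §4.10 p. 58] -/
theorem labelledOddCount_div_relIndex_coreHanging_eq_of_collapse [CompleteSpace K] [Finite 𝓀[K]] {σ : K →+* K} {ϖ : K} {d t : ℕ}
    (hD : IsRamifiedQuadraticDatum σ ϖ d t) (h2 : Valued.v (2 : K) < 1)
    {ρ : ℕ} (hρ : 1 ≤ ρ) {x ζ f : K} (hx : Valued.v x = 1) (hζ : Valued.v ζ = 1) (hσf : σ f = f) (hf : Valued.v f = 1) (h1f : Valued.v (1 + f) = 1)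
    (V : GL (Fin 3) K) (hV : (V : Matrix (Fin 3) (Fin 3) K) = !![1, 0, 0; x, ϖ ^ ρ, 0; x * ζ + f * (x * ζ), ϖ ^ ρ * ζ, ϖ ^ (2 * ρ)])
    {α β : K} {N₀ n₁ n₂ n₃ : ℕ} (hE : IsElementDatum σ ϖ N₀ α β n₁ n₂ n₃) {mc : ℕ} (hℓN : d % 2 + 1 ≤ N₀) (hmN : d % 2 + 2 * d - 1 ≤ N₀)
    (hℓmc : 2 * (d % 2) + 1 ≤ mc) (hmmc : d % 2 + 2 * d - 1 + d % 2 ≤ mc)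
    {T : GL (Fin 3) K} (hT : (T : Matrix (Fin 3) (Fin 3) K) = Matrix.diagonal ![α, β, 1]) (hM0 : latt (V : Matrix (Fin 3) (Fin 3) K) ∈ normalisedStableLattices T)
    (hlev : LatticeInLevel ϖ (d % 2) (Matrix.diagonal ![α - 1, β - 1, 0]) (latt (V : Matrix (Fin 3) (Fin 3) K)))
    (hnlev : ¬ LatticeInLevel ϖ (d % 2 + 1) (Matrix.diagonal ![α - 1, β - 1, 0]) (latt (V : Matrix (Fin 3) (Fin 3) K)))
    (hsq : LatticeInLevel ϖ mc (Matrix.diagonal ![(α - 1) * (α - 1), (β - 1) * (β - 1), 0]) (latt (V : Matrix (Fin 3) (Fin 3) K)))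
    {gα gβ : K} (hσgα : σ gα = gα) (hσgβ : σ gβ = gβ)
    (hgα : Valued.v ((ϖ ^ (d % 2 + 2 * d - 1))⁻¹ * (((ϖ * σ ϖ) ^ ρ)⁻¹ * ((α - 1) - gα * ((ϖ - σ ϖ) * ((ϖ * σ ϖ) ^ ((d - d % 2) / 2))⁻¹)))) ≤ 1)
    (hgβ : Valued.v ((ϖ ^ (d % 2 + 2 * d - 1))⁻¹ * (((ϖ * σ ϖ) ^ ρ)⁻¹ * ((β - 1) - gβ * ((ϖ - σ ϖ) * ((ϖ * σ ϖ) ^ ((d - d % 2) / 2))⁻¹)))) ≤ 1)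
    (k : Fin 3) {ε : ℤ} (hε : ε = 1 ∨ ε = -1)
    (hcol : ∀ u ∈ fixedUnitStabilizer σ (latt (V : Matrix (Fin 3) (Fin 3) K)),
      ((u 0 : Kˣ) : K) * f * gα + ((u 1 : Kˣ) : K) * gβ ≠ 0 ∧
        normSign σ (((u 0 : Kˣ) : K) * f * gα + ((u 1 : Kˣ) : K) * gβ) = ε * normSign σ ((u k : Kˣ) : K))
    (i : Fin 3) :
    (labelledOddCount σ ϖ 0 i (valueClassLabel σ ϖ (α - 1) (β - 1) (d % 2 + 2 * d - 1) d) (latt (V : Matrix (Fin 3) (Fin 3) K)) : ℚ) /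
        ((((unitStabilizer (latt (V : Matrix (Fin 3) (Fin 3) K))).map (unitNormMap σ 3)).relIndex (fixedUnitTorus σ 3) : ℕ) : ℚ) =
      stabiliserWeight σ (latt (V : Matrix (Fin 3) (Fin 3) K)) / 2 *
        ((((![normSign σ f, 1, normSign σ (-(1 + f))] : Fin 3 → ℤ) i * ε * (if i = k ∨ 2 * d - 1 ≤ ρ then 1 else 0) : ℤ)) : ℚ) := by
  classical
  have hTr := trace_bound_of_isRamifiedQuadraticDatum hD h2
  obtain ⟨hσ, hvσ, hϖ, hfix, hdd, hd1, -⟩ := id hD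
  haveI := isAdicComplete_valuedInteger_of_completeSpace hϖ
  have hϖ0 : ϖ ≠ 0 := fun h => by rw [h, map_zero] at hϖ; exact (exp_ne_zero hϖ.symm).elim
  have hϖ1 : Valued.v ϖ < 1 := by rw [hϖ, ← exp_zero, exp_lt_exp]; norm_num
  have hζ0 : ζ ≠ 0 := fun h => by rw [h, map_zero] at hζ; exact zero_ne_one hζ
  have hx0 : x ≠ 0 := fun h => by rw [h, map_zero] at hx; exact zero_ne_one hx
  have hf0 : f ≠ 0 := fun h => by rw [h, map_zero] at hf; exact zero_ne_one hf
  have h1f0 : 1 + f ≠ 0 := fun h => by rw [h, map_zero] at h1f; exact zero_ne_one h1f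
  -- the unit letters of the member
  have hy''1 : Valued.v (f * (x * ζ)) = 1 := by rw [map_mul, map_mul, hf, hx, hζ, one_mul, one_mul]
  have hy1 : Valued.v (x * ζ + f * (x * ζ)) = 1 := by
    rw [show x * ζ + f * (x * ζ) = x * ζ * (1 + f) by ring, map_mul, map_mul, hx, hζ, h1f, one_mul, one_mul]
  -- ★ κH (A1): the explicit polarisation with lineariser `f′ = f·Nζ`
  have hσf' : σ (f * (ζ * σ ζ)) = f * (ζ * σ ζ) := by rw [map_mul, map_mul, hσf, hσ, mul_comm (σ ζ) ζ]
  have hR : Valued.v (ζ * σ (f * (x * ζ)) - σ x * (f * (ζ * σ ζ))) ≤ Valued.v ϖ ^ ρ := by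
    rw [show ζ * σ (f * (x * ζ)) - σ x * (f * (ζ * σ ζ)) = 0 by rw [map_mul, map_mul, hσf]; ring, map_zero]; exact zero_le
  obtain ⟨D, ⟨hD1, hD2, hD0⟩, hDσ, hDV⟩ := exists_explicit_polarisation_latt_hnf_coreHanging hσ hvσ hϖ0 hϖ1 hTr ρ hρ hx hζ hy''1 hy1 V hV hσf' hR
  obtain ⟨hω1, hω2, hω0⟩ := normSign_polarisation_coreHanging σ hϖ0 ρ hx hζ hσf hf h1f hD1 hD2 hD0
  -- `D₀ = D₁·N(x)·f`
  have hN0 : ζ * σ ζ ≠ 0 := mul_ne_zero hζ0 ((map_ne_zero σ).2 hζ0)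
  have hσϖ0 : σ ϖ ≠ 0 := (map_ne_zero σ).2 hϖ0
  have hπ0 : ((ϖ * σ ϖ) ^ ρ : K) ≠ 0 := pow_ne_zero _ (mul_ne_zero hϖ0 hσϖ0)
  have hσζ0 : σ ζ ≠ 0 := (map_ne_zero σ).2 hζ0
  have hσx0 : σ x ≠ 0 := (map_ne_zero σ).2 hx0
  have hNf : ζ * σ ζ + f * (ζ * σ ζ) ≠ 0 := by
    rw [show ζ * σ ζ + f * (ζ * σ ζ) = ζ * σ ζ * (1 + f) by ring]; exact mul_ne_zero hN0 h1f0
  have hD0' : D 0 = D 1 * (x * σ x) * f := by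
    have hy : x * ζ + f * (x * ζ) = x * ζ * (1 + f) := by ring
    rw [hD0, hD1, hy, map_mul, map_mul, map_add, map_one, hσf]
    field_simp
    ring
  -- normalised; the type-0 fibre is one `S_F`-coset; the orbit is finite; the NI2 letters
  have hnorm : IsNormalisedLattice (latt (V : Matrix (Fin 3) (Fin 3) K)) := by rw [hV]; exact isNormalisedLattice_latt_coreHanging hϖ1.le ρ hx hζ hy1
  have hcoset : ∀ D' : Fin 3 → K, (∀ j, σ (D' j) = D' j ∧ D' j ≠ 0) →
      (IsVertexLattice σ ϖ (Matrix.diagonal D') 0 (latt (V : Matrix (Fin 3) (Fin 3) K)) ↔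
        ∃ u ∈ fixedUnitStabilizer σ (latt (V : Matrix (Fin 3) (Fin 3) K)), ∀ j, D' j = D j * ((u j : Kˣ) : K)) :=
    fun D' hD' => fibre_isCoset_zero hvσ ϖ V rfl hnorm D hDσ hDV D' hD'
  have hfin := finite_unitTorus_orbit_of_mem_normalisedStableLattices hϖ (v_diag_eq_one hvσ hE) (diag_regular hE) T hT hM0
  obtain ⟨c, hσc, hcv, hcn, hdich⟩ := exists_nonnorm_dichotomy_of_isRamifiedQuadraticDatum σ ϖ d t hD
  have hTM : mapGL T (latt (V : Matrix (Fin 3) (Fin 3) K)) = latt (V : Matrix (Fin 3) (Fin 3) K) := hM0.2.1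
  -- the sign `ε = ω(g_α)ω(1+f)` and the ONE-SLOT label in slot 2 (§1 + FILE 2a)
  have hΛ : ∀ u ∈ fixedUnitStabilizer σ (latt (V : Matrix (Fin 3) (Fin 3) K)),
      valueClassLabel σ ϖ (α - 1) (β - 1) (d % 2 + 2 * d - 1) d (latt (V : Matrix (Fin 3) (Fin 3) K)) (fun j => D j * ((u j : Kˣ) : K)) ↔
        ε * normSign σ ((u k : Kˣ) : K) = 1 := by
    intro u hu
    have hufix : ∀ j, σ ((u j : Kˣ) : K) = u j := fun j => ((mem_fixedUnitTorus_iff σ u).1 hu.2).2 j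
    have huv : ∀ j, Valued.v ((u j : Kˣ) : K) = 1 := fun j => ((mem_fixedUnitTorus_iff σ u).1 hu.2).1 j
    have hDu : ∀ j, σ (D j * ((u j : Kˣ) : K)) = D j * ((u j : Kˣ) : K) ∧ D j * ((u j : Kˣ) : K) ≠ 0 := fun j =>
      ⟨by rw [map_mul, (hDσ j).1, hufix j], mul_ne_zero (hDσ j).2 (u j).ne_zero⟩
    have hMu : IsVertexLattice σ ϖ (Matrix.diagonal fun j => D j * ((u j : Kˣ) : K)) 0 (latt (V : Matrix (Fin 3) (Fin 3) K)) :=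
      (hcoset _ hDu).2 ⟨u, hu, fun _ => rfl⟩
    -- the weights `D₀u₀ = π₀^{−ρ}·(N(x) f u₀)` and `D₁u₁N(x) = π₀^{−ρ}·(u₁ N(x))` are `π₀^{−ρ}` times units
    have hwt0 : Valued.v (x * σ x * f * ((u 0 : Kˣ) : K)) ≤ 1 := by rw [map_mul, map_mul, map_mul, hx, hvσ, hx, hf, huv 0]; norm_num
    have hwt1 : Valued.v (((u 1 : Kˣ) : K) * (x * σ x)) ≤ 1 := by rw [map_mul, map_mul, huv 1, hx, hvσ, hx]; norm_num
    have hgαu : Valued.v ((ϖ ^ (d % 2 + 2 * d - 1))⁻¹ *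
        (D 0 * ((u 0 : Kˣ) : K) * ((α - 1) - gα * ((ϖ - σ ϖ) * ((ϖ * σ ϖ) ^ ((d - d % 2) / 2))⁻¹)))) ≤ 1 := by
      have e : (ϖ ^ (d % 2 + 2 * d - 1))⁻¹ * (D 0 * ((u 0 : Kˣ) : K) * ((α - 1) - gα * ((ϖ - σ ϖ) * ((ϖ * σ ϖ) ^ ((d - d % 2) / 2))⁻¹))) =
          (x * σ x * f * ((u 0 : Kˣ) : K)) * ((ϖ ^ (d % 2 + 2 * d - 1))⁻¹ * (((ϖ * σ ϖ) ^ ρ)⁻¹ * ((α - 1) - gα * ((ϖ - σ ϖ) * ((ϖ * σ ϖ) ^ ((d - d % 2) / 2))⁻¹)))) := by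
        rw [hD0', hD1]; ring
      rw [e, map_mul]; exact mul_le_one' hwt0 hgα
    have hgβu : Valued.v ((ϖ ^ (d % 2 + 2 * d - 1))⁻¹ *
        (D 1 * ((u 1 : Kˣ) : K) * (x * σ x) * ((β - 1) - gβ * ((ϖ - σ ϖ) * ((ϖ * σ ϖ) ^ ((d - d % 2) / 2))⁻¹)))) ≤ 1 := by
      have e : (ϖ ^ (d % 2 + 2 * d - 1))⁻¹ * (D 1 * ((u 1 : Kˣ) : K) * (x * σ x) * ((β - 1) - gβ * ((ϖ - σ ϖ) * ((ϖ * σ ϖ) ^ ((d - d % 2) / 2))⁻¹))) =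
          (((u 1 : Kˣ) : K) * (x * σ x)) * ((ϖ ^ (d % 2 + 2 * d - 1))⁻¹ * (((ϖ * σ ϖ) ^ ρ)⁻¹ * ((β - 1) - gβ * ((ϖ - σ ϖ) * ((ϖ * σ ϖ) ^ ((d - d % 2) / 2))⁻¹)))) := by
        rw [hD1]; ring
      rw [e, map_mul]; exact mul_le_one' hwt1 hgβ
    have hread := valueClassLabel_latt_coreHanging_iff_normSign_linear hD hρ hx hζ hy1 V hV (D := fun j => D j * ((u j : Kˣ) : K))
      (fun j => (hDu j).1) (fun j => (hDu j).2) hMu hE hℓN hmN hℓmc hmmc hlev hnlev hsq hT hTM hσgα hσgβ hgαu hgβu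
    rw [hread]
    -- `D₀u₀·g_α + D₁u₁·N(x)·g_β = (D₁·N(x)) · (u₀ f g_α + u₁ g_β)`, and `ω(D₁·N(x)) = 1`
    have hfac : D 0 * ((u 0 : Kˣ) : K) * gα + D 1 * ((u 1 : Kˣ) : K) * (x * σ x) * gβ =
        (D 1 * (x * σ x)) * (((u 0 : Kˣ) : K) * f * gα + ((u 1 : Kˣ) : K) * gβ) := by rw [hD0']; ring
    have hσD1x : σ (D 1 * (x * σ x)) = D 1 * (x * σ x) := by rw [map_mul, (hDσ 1).1, map_mul, hσ, mul_comm (σ x) x]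
    have hD1x0 : D 1 * (x * σ x) ≠ 0 := mul_ne_zero (hDσ 1).2 (mul_ne_zero hx0 ((map_ne_zero σ).2 hx0))
    have hωD1x : normSign σ (D 1 * (x * σ x)) = 1 := by
      rw [normSign_mul_of_fixed hD (hDσ 1).1 (by rw [map_mul, hσ, mul_comm]) (hDσ 1).2 (mul_ne_zero hx0 ((map_ne_zero σ).2 hx0)), hω1, one_mul]
      exact normSign_of_isNorm σ ⟨x, rfl⟩
    have hS0 : σ (((u 0 : Kˣ) : K) * f * gα + ((u 1 : Kˣ) : K) * gβ) = ((u 0 : Kˣ) : K) * f * gα + ((u 1 : Kˣ) : K) * gβ := by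
      rw [map_add, map_mul, map_mul, map_mul, hufix 0, hσf, hσgα, hufix 1, hσgβ]
    have hZ := hcol u hu
    rw [hfac, normSign_mul_of_fixed hD hσD1x hS0 hD1x0 hZ.1, hωD1x, one_mul, hZ.2]
  -- ★ ONE-SLOT head at `k = 2`
  have hhead := labelledOddCount_div_relIndex_eq_of_oneSlot hσ hvσ hσc hcv hcn hdich hfin hDσ hDV hcoset
    (valueClassLabel σ ϖ (α - 1) (β - 1) (d % 2 + 2 * d - 1) d) i k hε hΛ
  rw [hhead]
  -- the ω-table of `D` and the alive ∕ dead window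
  have hV0 : (V : Matrix (Fin 3) (Fin 3) K) = !![1, 0, 0; x, ϖ ^ ρ, 0; x * ζ + f * (x * ζ), ϖ ^ ρ * ζ, ϖ ^ (2 * ρ + 0)] := by rw [Nat.add_zero]; exact hV
  have hωD : ∀ j : Fin 3, normSign σ (D j) = (![normSign σ f, 1, normSign σ (-(1 + f))] : Fin 3 → ℤ) j := fun j => by
    fin_cases j
    · exact hω0
    · exact hω1
    · exact hω2
  -- the pair indicator `[ω(u_i)ω(u_2) ≡ 1 on S_F]`
  -- the pair indicator `[ω(u_i)ω(u_k) ≡ 1 on S_F]`: `1` on the diagonal, ★ κH-A2's alive ∕ dead window off it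
  have hind : (if ∀ u ∈ fixedUnitStabilizer σ (latt (V : Matrix (Fin 3) (Fin 3) K)), normSign σ ((u i : Kˣ) : K) * normSign σ ((u k : Kˣ) : K) = 1 then (1 : ℤ) else 0) =
      (if i = k ∨ 2 * d - 1 ≤ ρ then 1 else 0) := by
    by_cases hik : i = k
    · subst hik
      rw [if_pos (fun u _ => normSign_mul_self σ _), if_pos (Or.inl rfl)]
    by_cases hal : 2 * d - 1 ≤ ρ
    · rw [if_pos (Or.inr hal : i = k ∨ 2 * d - 1 ≤ ρ), if_pos]
      intro u hu
      have H0 := chiVec_eq_one_of_mem_fixedUnitStabilizer_of_le hD ρ hx hζ hf V hV0 hal hu 0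
      have H1 := chiVec_eq_one_of_mem_fixedUnitStabilizer_of_le hD ρ hx hζ hf V hV0 hal hu 1
      have H2 := chiVec_eq_one_of_mem_fixedUnitStabilizer_of_le hD ρ hx hζ hf V hV0 hal hu 2
      rw [chiVec_apply] at H0 H1 H2
      simp only [cons_val_zero, cons_val_one, cons_val_two, Nat.succ_eq_add_one, Nat.reduceAdd, tail_cons, head_cons] at H0 H1 H2
      fin_cases i <;> fin_cases k
      all_goals first | exact (hik rfl).elim | skip
      all_goals simp only [Fin.zero_eta, Fin.mk_one, Fin.reduceFinMk, Fin.isValue]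
      all_goals first
        | exact H0
        | exact H1
        | exact H2
        | exact (mul_comm _ _).trans H0
        | exact (mul_comm _ _).trans H1
        | exact (mul_comm _ _).trans H2
    · have hR : (if i = k ∨ 2 * d - 1 ≤ ρ then (1 : ℤ) else 0) = 0 := if_neg (not_or.2 ⟨hik, hal⟩)
      rw [hR, ite_eq_right_iff]
      intro hall
      exfalso
      have hlt : ρ ≤ 2 * d - 2 := by omega
      have E0 := exists_mem_fixedUnitStabilizer_chiVec_ne_one_of_lt hD h2 ρ hx hζ hσf hf h1f V hV0 hlt 0
      have E1 := exists_mem_fixedUnitStabilizer_chiVec_ne_one_of_lt hD h2 ρ hx hζ hσf hf h1f V hV0 hlt 1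
      have E2 := exists_mem_fixedUnitStabilizer_chiVec_ne_one_of_lt hD h2 ρ hx hζ hσf hf h1f V hV0 hlt 2
      simp only [chiVec_apply, cons_val_zero, cons_val_one, cons_val_two, Nat.succ_eq_add_one, Nat.reduceAdd, tail_cons, head_cons] at E0 E1 E2
      fin_cases i <;> fin_cases k
      all_goals first | exact (hik rfl).elim | skip
      all_goals simp only [Fin.zero_eta, Fin.mk_one, Fin.reduceFinMk, Fin.isValue] at hall
      all_goals first
        | (obtain ⟨u, hu, hne⟩ := E0; exact hne (hall u hu))
        | (obtain ⟨u, hu, hne⟩ := E1; exact hne (hall u hu))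
        | (obtain ⟨u, hu, hne⟩ := E2; exact hne (hall u hu))
        | (obtain ⟨u, hu, hne⟩ := E0; exact hne ((mul_comm _ _).trans (hall u hu)))
        | (obtain ⟨u, hu, hne⟩ := E1; exact hne ((mul_comm _ _).trans (hall u hu)))
        | (obtain ⟨u, hu, hne⟩ := E2; exact hne ((mul_comm _ _).trans (hall u hu)))
  rw [hind, hωD]
  push_cast
  ring

/-! ## §2  The collapse for the key `(m, m, L)` down to the boundary: `ω(u₀·f·g_α + u₁·g_β) = ω(f·g_α + g_β)·ω(u₂)` on `S_F` -/

/-- **COLLAPSE, KEY `(m, m, L)`, DEEP OR BOUNDARY.**  Ramified datum on a complete field; core-hanging member `M = latt(1 0 0; x ϖ^ρ 0; xζ+f·xζ ϖ^ρζ ϖ^{2ρ})` (`x, ζ` units, `f` a fixed unit,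
`|1+f| = 1`); fixed `g_α, g_β` with `G := f·g_α + g_β ≠ 0` and the two smallness letters `|ϖ|^{2ρ}·|g_α| ≤ |ϖ|^{2d−1}·|G|`, `|ϖ|^ρ·|g_β − g_α| ≤ |ϖ|^{2d−1}·|G|`.  Then for every
`u ∈ S_F(M)`: `u₀·f·g_α + u₁·g_β ≠ 0` and `normSign σ (u₀·f·g_α + u₁·g_β) = normSign σ (f·g_α + g_β) · normSign σ u₂`
(★ `S_F` letters `|u₂ − u₁| ≤ |ϖ|^ρ`, `|f⁻¹(u₂−u₁) + (u₂−u₀)| ≤ |ϖ|^{2ρ}`; the identity `u₀fg_α + u₁g_β = u₂G + g_α((u₀f+u₁) − (1+f)u₂) + (u₁−u₂)(g_β−g_α)`; ★ toolkit §3–§4).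
[cite: Serre1979, Ch. XV §2] [cite: Kottwitz1986BaseChangeUnits, §1 pp. 240–241] -/
theorem normSign_twoSlot_eq_of_near₃ [CompleteSpace K] [Finite 𝓀[K]] {σ : K →+* K} {ϖ : K} {d t : ℕ} (hD : IsRamifiedQuadraticDatum σ ϖ d t)
    {ρ : ℕ} {x ζ f : K} (hx : Valued.v x = 1) (hζ : Valued.v ζ = 1) (hσf : σ f = f) (hf : Valued.v f = 1)
    (V : GL (Fin 3) K) (hV : (V : Matrix (Fin 3) (Fin 3) K) = !![1, 0, 0; x, ϖ ^ ρ, 0; x * ζ + f * (x * ζ), ϖ ^ ρ * ζ, ϖ ^ (2 * ρ)])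
    {gα gβ : K} (hσgα : σ gα = gα) (hσgβ : σ gβ = gβ) (hG0 : f * gα + gβ ≠ 0)
    (hdom : Valued.v ϖ ^ (2 * ρ) * Valued.v gα ≤ Valued.v ϖ ^ (2 * d - 1) * Valued.v (f * gα + gβ))
    (hnear : Valued.v ϖ ^ ρ * Valued.v (gβ - gα) ≤ Valued.v ϖ ^ (2 * d - 1) * Valued.v (f * gα + gβ))
    {u : Fin 3 → Kˣ} (hu : u ∈ fixedUnitStabilizer σ (latt (V : Matrix (Fin 3) (Fin 3) K))) :
    ((u 0 : Kˣ) : K) * f * gα + ((u 1 : Kˣ) : K) * gβ ≠ 0 ∧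
      normSign σ (((u 0 : Kˣ) : K) * f * gα + ((u 1 : Kˣ) : K) * gβ) = normSign σ (f * gα + gβ) * normSign σ ((u 2 : Kˣ) : K) := by
  obtain ⟨hσ, hvσ, hϖ, hfix, hdd, hd1, -⟩ := id hD
  have hϖ0 : ϖ ≠ 0 := fun h => by rw [h, map_zero] at hϖ; exact (exp_ne_zero hϖ.symm).elim
  have hϖ1 : Valued.v ϖ ≤ 1 := by rw [hϖ, ← exp_zero, exp_le_exp]; norm_num
  have hf0 : f ≠ 0 := fun h => by rw [h, map_zero] at hf; exact zero_ne_one hf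
  have huT : u ∈ fixedUnitTorus σ 3 := hu.2
  have hufix : ∀ j, σ ((u j : Kˣ) : K) = u j := fun j => ((mem_fixedUnitTorus_iff σ u).1 huT).2 j
  have huv : ∀ j, Valued.v ((u j : Kˣ) : K) = 1 := fun j => ((mem_fixedUnitTorus_iff σ u).1 huT).1 j
  -- the ★ `S_F` letters at `s = 0` with lineariser `1∕f`
  have hV0 : (V : Matrix (Fin 3) (Fin 3) K) = !![1, 0, 0; x, ϖ ^ ρ, 0; x * ζ + f * (x * ζ), ϖ ^ ρ * ζ, ϖ ^ (2 * ρ + 0)] := by rw [Nat.add_zero]; exact hV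
  have hmem := (mem_fixedUnitStabilizer_latt_glued_iff (σ := σ) hϖ0 hϖ1 ρ 0 (x := x) (ζ := ζ) (y'' := f * (x * ζ)) (g := f⁻¹) hx hζ
    (by rw [pow_zero, map_mul, map_mul, hf, hx, hζ, one_mul, one_mul]) (by rw [pow_zero, mul_one, map_inv₀, hf, inv_one])
    (by rw [show x * ζ - f⁻¹ * (f * (x * ζ)) = 0 by rw [← mul_assoc, inv_mul_cancel₀ hf0, one_mul, sub_self], map_zero]; exact zero_le) V hV0 huT).1 hu
  obtain ⟨h10, h20⟩ := hmem
  rw [Nat.add_zero] at h10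
  -- `|(u₀f + u₁) − (1+f)u₂| ≤ |ϖ|^{2ρ}`
  have hrel : Valued.v ((((u 0 : Kˣ) : K) * f + u 1) - (1 + f) * ((u 2 : Kˣ) : K)) ≤ Valued.v ϖ ^ (2 * ρ) := by
    have e : (((u 0 : Kˣ) : K) * f + u 1) - (1 + f) * ((u 2 : Kˣ) : K) = -(f * (f⁻¹ * (((u 2 : Kˣ) : K) - u 1) + (((u 2 : Kˣ) : K) - u 0))) := by
      field_simp; ring
    rw [e, Valuation.map_neg, map_mul, hf, one_mul]; exact h20
  -- the decomposition `u₀ f g_α + u₁ g_β = u₂·G + E`, `G = f g_α + g_β`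
  obtain ⟨E, hE⟩ : ∃ E : K, E = gα * ((((u 0 : Kˣ) : K) * f + u 1) - (1 + f) * ((u 2 : Kˣ) : K)) + (((u 1 : Kˣ) : K) - u 2) * (gβ - gα) := ⟨_, rfl⟩
  have hdec : ((u 0 : Kˣ) : K) * f * gα + ((u 1 : Kˣ) : K) * gβ = ((u 2 : Kˣ) : K) * (f * gα + gβ) + E := by rw [hE]; ring
  have hvG : 0 < Valued.v (f * gα + gβ) := (Valuation.pos_iff _).2 hG0
  -- `|E| ≤ |ϖ|^{2d−1}·|G|`
  have hEle : Valued.v E ≤ Valued.v ϖ ^ (2 * d - 1) * Valued.v (f * gα + gβ) := by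
    rw [hE]
    refine (Valuation.map_add _ _ _).trans (max_le ?_ ?_)
    · rw [map_mul, mul_comm]
      exact (mul_le_mul' hrel le_rfl).trans hdom
    · rw [map_mul, Valuation.map_sub_swap]
      exact (mul_le_mul' h10 le_rfl).trans hnear
  -- `y := 1 + E∕(u₂ G)` is a fixed unit with `|y − 1| ≤ |ϖ|^{2d−1}`, hence a norm: `ω(y) = 1`
  have hu20 : ((u 2 : Kˣ) : K) ≠ 0 := (u 2).ne_zero
  have hW0 : ((u 2 : Kˣ) : K) * (f * gα + gβ) ≠ 0 := mul_ne_zero hu20 hG0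
  obtain ⟨y, hy⟩ : ∃ y : K, y = 1 + E / (((u 2 : Kˣ) : K) * (f * gα + gβ)) := ⟨_, rfl⟩
  have hσG : σ (f * gα + gβ) = f * gα + gβ := by rw [map_add, map_mul, hσf, hσgα, hσgβ]
  have hσE : σ E = E := by rw [hE]; simp only [map_add, map_mul, map_sub, map_one, hσf, hufix, hσgα, hσgβ]
  have hσy : σ y = y := by rw [hy, map_add, map_one, map_div₀, hσE, map_mul, hufix 2, hσG]
  have hy1 : Valued.v (y - 1) ≤ Valued.v ϖ ^ (2 * d - 1) := by
    rw [hy, add_sub_cancel_left, map_div₀, map_mul, huv 2, one_mul, div_le_iff₀ hvG]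
    exact hEle
  have hωy : normSign σ y = 1 := normSign_eq_one_of_fixed_of_v_sub_one_le hD hσy le_rfl hy1
  have hlt : Valued.v ϖ ^ (2 * d - 1) < 1 := pow_lt_one₀ zero_le (by rw [hϖ, ← exp_zero, exp_lt_exp]; norm_num) (by omega)
  have hvy : Valued.v y = 1 := by
    have e : y = 1 + (y - 1) := by ring
    rw [e]; exact Valuation.map_one_add_of_lt _ (hy1.trans_lt hlt)
  have hy0 : y ≠ 0 := fun h0 => by rw [h0, map_zero] at hvy; exact zero_ne_one hvy
  have hfac : ((u 0 : Kˣ) : K) * f * gα + ((u 1 : Kˣ) : K) * gβ = (((u 2 : Kˣ) : K) * (f * gα + gβ)) * y := by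
    have e : (((u 2 : Kˣ) : K) * (f * gα + gβ)) * y = ((u 2 : Kˣ) : K) * (f * gα + gβ) + E := by
      rw [hy, mul_add, mul_one, mul_div_cancel₀ _ hW0]
    rw [e]; exact hdec
  refine ⟨by rw [hfac]; exact mul_ne_zero hW0 hy0, ?_⟩
  rw [hfac, normSign_mul_of_fixed hD (by rw [map_mul, hufix 2, hσG]) hσy hW0 hy0, hωy, mul_one,
    normSign_mul_of_fixed hD (hufix 2) hσG hu20 hG0, mul_comm]

/-! ## §3  The per-lattice value for the key `(m, m, L)`, deep or boundary (§1 at `k = 2`, §2) -/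

/-- **THE LABELLED-ODD VALUE OF A CORE-HANGING LATTICE, KEY `(m, m, L)` DOWN TO THE BOUNDARY** (§1 with the §2 collapse, `k = 2`, `ε = ω(f·g_α + g_β)`):
`labelledOddCount σ ϖ 0 i Λ M ∕ [𝒰 : N(S̃(M))] = stabiliserWeight σ M ∕ 2 · (ω(f), 1, ω(−(1+f)))_i · ω(f·g_α + g_β) · [i = 2 ∨ 2d−1 ≤ ρ]` under the §2 letters
`f·g_α + g_β ≠ 0`, `|ϖ|^{2ρ}|g_α| ≤ |ϖ|^{2d−1}|f g_α + g_β|`, `|ϖ|^ρ|g_β − g_α| ≤ |ϖ|^{2d−1}|f g_α + g_β|`.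
[cite: Kottwitz1986BaseChangeUnits, §1 pp. 240–241] [cite: LanglandsShelstad1987, §3] [cite: Rogawski1990, §4.9 Prop. 4.9.1 (a)(b) p. 55, §4.10 p. 58] -/
theorem labelledOddCount_div_relIndex_coreHanging_eq_of_near₃ [CompleteSpace K] [Finite 𝓀[K]] {σ : K →+* K} {ϖ : K} {d t : ℕ}
    (hD : IsRamifiedQuadraticDatum σ ϖ d t) (h2 : Valued.v (2 : K) < 1)
    {ρ : ℕ} (hρ : 1 ≤ ρ) {x ζ f : K} (hx : Valued.v x = 1) (hζ : Valued.v ζ = 1) (hσf : σ f = f) (hf : Valued.v f = 1) (h1f : Valued.v (1 + f) = 1)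
    (V : GL (Fin 3) K) (hV : (V : Matrix (Fin 3) (Fin 3) K) = !![1, 0, 0; x, ϖ ^ ρ, 0; x * ζ + f * (x * ζ), ϖ ^ ρ * ζ, ϖ ^ (2 * ρ)])
    {α β : K} {N₀ n₁ n₂ n₃ : ℕ} (hE : IsElementDatum σ ϖ N₀ α β n₁ n₂ n₃) {mc : ℕ} (hℓN : d % 2 + 1 ≤ N₀) (hmN : d % 2 + 2 * d - 1 ≤ N₀)
    (hℓmc : 2 * (d % 2) + 1 ≤ mc) (hmmc : d % 2 + 2 * d - 1 + d % 2 ≤ mc)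
    {T : GL (Fin 3) K} (hT : (T : Matrix (Fin 3) (Fin 3) K) = Matrix.diagonal ![α, β, 1]) (hM0 : latt (V : Matrix (Fin 3) (Fin 3) K) ∈ normalisedStableLattices T)
    (hlev : LatticeInLevel ϖ (d % 2) (Matrix.diagonal ![α - 1, β - 1, 0]) (latt (V : Matrix (Fin 3) (Fin 3) K)))
    (hnlev : ¬ LatticeInLevel ϖ (d % 2 + 1) (Matrix.diagonal ![α - 1, β - 1, 0]) (latt (V : Matrix (Fin 3) (Fin 3) K)))
    (hsq : LatticeInLevel ϖ mc (Matrix.diagonal ![(α - 1) * (α - 1), (β - 1) * (β - 1), 0]) (latt (V : Matrix (Fin 3) (Fin 3) K)))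
    {gα gβ : K} (hσgα : σ gα = gα) (hσgβ : σ gβ = gβ) (hG0 : f * gα + gβ ≠ 0)
    (hdom : Valued.v ϖ ^ (2 * ρ) * Valued.v gα ≤ Valued.v ϖ ^ (2 * d - 1) * Valued.v (f * gα + gβ))
    (hnear : Valued.v ϖ ^ ρ * Valued.v (gβ - gα) ≤ Valued.v ϖ ^ (2 * d - 1) * Valued.v (f * gα + gβ))
    (hgα : Valued.v ((ϖ ^ (d % 2 + 2 * d - 1))⁻¹ * (((ϖ * σ ϖ) ^ ρ)⁻¹ * ((α - 1) - gα * ((ϖ - σ ϖ) * ((ϖ * σ ϖ) ^ ((d - d % 2) / 2))⁻¹)))) ≤ 1)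
    (hgβ : Valued.v ((ϖ ^ (d % 2 + 2 * d - 1))⁻¹ * (((ϖ * σ ϖ) ^ ρ)⁻¹ * ((β - 1) - gβ * ((ϖ - σ ϖ) * ((ϖ * σ ϖ) ^ ((d - d % 2) / 2))⁻¹)))) ≤ 1)
    (i : Fin 3) :
    (labelledOddCount σ ϖ 0 i (valueClassLabel σ ϖ (α - 1) (β - 1) (d % 2 + 2 * d - 1) d) (latt (V : Matrix (Fin 3) (Fin 3) K)) : ℚ) /
        ((((unitStabilizer (latt (V : Matrix (Fin 3) (Fin 3) K))).map (unitNormMap σ 3)).relIndex (fixedUnitTorus σ 3) : ℕ) : ℚ) =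
      stabiliserWeight σ (latt (V : Matrix (Fin 3) (Fin 3) K)) / 2 *
        ((((![normSign σ f, 1, normSign σ (-(1 + f))] : Fin 3 → ℤ) i * normSign σ (f * gα + gβ) * (if i = 2 ∨ 2 * d - 1 ≤ ρ then 1 else 0) : ℤ)) : ℚ) :=
  labelledOddCount_div_relIndex_coreHanging_eq_of_collapse hD h2 hρ hx hζ hσf hf h1f V hV hE hℓN hmN hℓmc hmmc hT hM0 hlev hnlev hsq hσgα hσgβ hgα hgβ 2
    (by unfold normSign; split_ifs <;> simp) (fun u hu => normSign_twoSlot_eq_of_near₃ hD hx hζ hσf hf V hV hσgα hσgβ hG0 hdom hnear hu) i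

end Summit.HodgeConjecture.HodgeConjecture.Cruxes.H413.F0P3cDyRamLabelledOddCoreHangingCollapsedRead

end
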